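import Literature.Computability.MetaComplexity.LinearMapResolutionWidthProofs
import HarnessLib

/-!
# The `Res(k)` rung for expanding linear systems, I: the closure of a small variable set

Support file for `stmt-PneNP-11443` (`LinearGeneratorDepthFregeHard`, Krajíček's Problem 19.4.5
in universal-expander form). This is the first file of the chain proving the `Res(k)` RUNG of the
ladder for ALL column weights (the "heavy" case included): every `Res(k)` refutation of the
XOR-CNF of an `ℓ`-sparse `(n^{1-δ}, 3ℓ/4)`-boundary expander has `≥ 2^{n^ε}` lines, for
`8k ≤ 3ℓ` and `δ (k² + k + 2) < 2`.

The method is a random restriction that PRESERVES EXPANSION (after M. Alekhnovich, *Lower bounds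
for k-DNF resolution on random 3-CNFs*, Comput. Complexity 20 (2011), §3, and the
Alekhnovich–Razborov closure operator), followed by the Segerlind–Buss–Impagliazzo switching
argument by covers and the Ben-Sasson–Wigderson width bound. This file contains the deterministic
combinatorics of the CLOSURE of a set `J` of variables in a system `E` whose row supports form an
`(r, c)`-boundary expander:

* `IsDerivable E r c J I`: `I` is obtained from `∅` by repeatedly adding a nonempty chunk `I'` of
  at most `r/2` fresh rows whose boundary outside `J` and outside the variables of the rows
  already taken has at most `(c/2)|I'|` points;
* `IsDerivable.card_boundary_sdiff_le`: a derivable set has `|∂I ∖ J| ≤ (c/2)|I|`;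
* `IsDerivable.half_c_mul_card_le`: if `|J ∩ [n]| ≤ c r / 4` then every derivable set has
  `(c/2)|I| ≤ |J ∩ [n]|`, hence `2|I| ≤ r`;
* `closure E r c J`: a derivable set of maximum cardinality; `assigned E r c J = J ∪ vars(closure)`;
* `lt_card_boundary_sdiff_assigned` (maximality): every nonempty family `F` of at most `r/2` rows
  outside the closure has MORE than `(c/2)|F|` boundary points outside `assigned` — the rows
  outside the closure form an `(r/2, c/2)`-boundary expander relative to the assigned variables
  (`relExpander_closure`).

All statements are about a fixed system `E : Fin m → LinEqMod 2 n`; the scopes are the row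
supports read in `ℕ` (`rowVars E i`), as in `IsBoundaryExpander` of the crux.
-/

namespace Summit.PneNP.PneNP.Theorems.ResKRestriction

open Finset Literature.Computability.Complexity Literature.Computability.MetaComplexity

variable {m n : ℕ}

/-! ### Scopes, boundaries of unions -/

/-- The scope of row `i`: its support, read as a set of natural numbers (the Boolean variables of
the `B = 1` sum-encoding). [Ben-Sasson–Wigderson 2001, §4.2] [folklore] -/
def rowVars (E : Fin m → LinEqMod 2 n) (i : Fin m) : Finset ℕ :=
  (E i).supp.map Fin.valEmbedding

/-- Membership in `rowVars`. [folklore] -/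
theorem mem_rowVars {E : Fin m → LinEqMod 2 n} {i : Fin m} {v : ℕ} :
    v ∈ rowVars E i ↔ ∃ j : Fin n, j ∈ (E i).supp ∧ (j : ℕ) = v := by
  simp [rowVars]

/-- A support element gives a row variable. [folklore] -/
theorem val_mem_rowVars {E : Fin m → LinEqMod 2 n} {i : Fin m} {j : Fin n} (hj : j ∈ (E i).supp) :
    (j : ℕ) ∈ rowVars E i :=
  mem_rowVars.2 ⟨j, hj, rfl⟩

/-- Row variables are `< n`. [folklore] -/
theorem lt_of_mem_rowVars {E : Fin m → LinEqMod 2 n} {i : Fin m} {v : ℕ} (hv : v ∈ rowVars E i) :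
    v < n := by
  obtain ⟨j, -, rfl⟩ := mem_rowVars.1 hv
  exact j.2

/-- Cover points of any family of rows are `< n`. [folklore] -/
theorem lt_of_mem_cover {E : Fin m → LinEqMod 2 n} {I : Finset (Fin m)} {v : ℕ}
    (hv : v ∈ cover (rowVars E) I) : v < n := by
  obtain ⟨i, -, hvi⟩ := mem_cover.1 hv
  exact lt_of_mem_rowVars hvi

/-- Boundary points of any family of rows are `< n`. [folklore] -/
theorem lt_of_mem_boundary {E : Fin m → LinEqMod 2 n} {I : Finset (Fin m)} {v : ℕ}
    (hv : v ∈ boundary (rowVars E) I) : v < n :=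
  lt_of_mem_cover (boundary_subset_cover (S := rowVars E) I hv)

/-- A point lying in exactly one scope of the family is a boundary point. [folklore] -/
theorem mem_boundary_of_unique {S : Fin m → Finset ℕ} {F : Finset (Fin m)} {i : Fin m} {v : ℕ}
    (hi : i ∈ F) (hvi : v ∈ S i) (huniq : ∀ j ∈ F, v ∈ S j → j = i) : v ∈ boundary S F := by
  rw [mem_boundary]
  refine ⟨mem_cover.2 ⟨i, hi, hvi⟩, ?_⟩
  unfold coverDegree
  rw [Finset.card_eq_one]
  refine ⟨i, Finset.eq_singleton_iff_unique_mem.2 ⟨by simp [hi, hvi], fun j hj => ?_⟩⟩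
  rw [Finset.mem_filter] at hj
  exact huniq j hj.1 hj.2

/-- **Boundary of a union**: a unique neighbour of `I ∪ I'` is a unique neighbour of `I`, or a
unique neighbour of `I'` not covered by `I`. [Alekhnovich 2011, §3 (closure)] [folklore] -/
theorem boundary_union_subset (S : Fin m → Finset ℕ) (I I' : Finset (Fin m)) :
    boundary S (I ∪ I') ⊆ boundary S I ∪ (boundary S I' \ cover S I) := by
  intro v hv
  obtain ⟨i, ⟨hi, hvi⟩, huniq⟩ := existsUnique_of_mem_boundary hv
  rw [Finset.mem_union, Finset.mem_sdiff]
  by_cases hc : v ∈ cover S I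
  · left
    obtain ⟨j, hjI, hvj⟩ := mem_cover.1 hc
    obtain rfl : j = i := huniq j ⟨Finset.mem_union_left _ hjI, hvj⟩
    exact mem_boundary_of_unique hjI hvj fun j' hj' hvj' =>
      huniq j' ⟨Finset.mem_union_left _ hj', hvj'⟩
  · right
    have hiI' : i ∈ I' := by
      rcases Finset.mem_union.1 hi with h | h
      · exact absurd (mem_cover.2 ⟨i, h, hvi⟩) hc
      · exact h
    exact ⟨mem_boundary_of_unique hiI' hvi fun j' hj' hvj' =>
      huniq j' ⟨Finset.mem_union_right _ hj', hvj'⟩, hc⟩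

/-! ### Derivable sets and their size -/

/-- `IsDerivable E r c J I`: the row set `I` is derivable from the variable set `J` — obtained
from `∅` by repeatedly adjoining a nonempty chunk `I'` of at most `r/2` rows, disjoint from the
rows taken so far, whose boundary has at most `(c/2)|I'|` points outside `J` and outside the
variables of the rows taken so far (Alekhnovich's / Alekhnovich–Razborov's closure inference).
[Alekhnovich 2011, §3; Alekhnovich–Razborov 2003, §3 (closure)] [folklore] -/
inductive IsDerivable (E : Fin m → LinEqMod 2 n) (r c : ℝ) (J : Finset ℕ) : Finset (Fin m) → Prop
  /-- the empty set is derivable -/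
  | empty : IsDerivable E r c J ∅
  /-- adjoining an admissible chunk -/
  | step {I I' : Finset (Fin m)} (hI : IsDerivable E r c J I) (hdisj : Disjoint I I')
      (hne : I'.Nonempty) (hsmall : 2 * (I'.card : ℝ) ≤ r)
      (hbd : (((boundary (rowVars E) I') \ (J ∪ cover (rowVars E) I)).card : ℝ) ≤ c / 2 * I'.card) :
      IsDerivable E r c J (I ∪ I')

variable {E : Fin m → LinEqMod 2 n} {r c : ℝ} {J : Finset ℕ}

/-- A derivable set has few boundary points outside `J`: `|∂I ∖ J| ≤ (c/2)|I|`.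
[Alekhnovich 2011, §3 (closure size)] [folklore] -/
theorem IsDerivable.card_boundary_sdiff_le {I : Finset (Fin m)} (h : IsDerivable E r c J I) :
    (((boundary (rowVars E) I) \ J).card : ℝ) ≤ c / 2 * I.card := by
  induction h with
  | empty => simp [boundary, cover]
  | @step I I' _ hdisj _ _ hbd ih =>
    have hsub : boundary (rowVars E) (I ∪ I') \ J ⊆
        (boundary (rowVars E) I \ J) ∪ (boundary (rowVars E) I' \ (J ∪ cover (rowVars E) I)) := by
      intro v hv
      rw [Finset.mem_sdiff] at hv
      have := boundary_union_subset (rowVars E) I I' hv.1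
      rw [Finset.mem_union, Finset.mem_sdiff] at this
      rw [Finset.mem_union, Finset.mem_sdiff, Finset.mem_sdiff, Finset.mem_union, not_or]
      tauto
    have h1 : (((boundary (rowVars E) (I ∪ I')) \ J).card : ℝ) ≤
        ((boundary (rowVars E) I \ J).card : ℝ) +
          ((boundary (rowVars E) I' \ (J ∪ cover (rowVars E) I)).card : ℝ) := by
      exact_mod_cast (Finset.card_le_card hsub).trans (Finset.card_union_le _ _)
    rw [Finset.card_union_of_disjoint hdisj, Nat.cast_add]
    linarith

/-- The system's variables inside `J`: `J ∩ [n]`. [folklore] -/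
def sysPart (n : ℕ) (J : Finset ℕ) : Finset ℕ :=
  J.filter fun v => v < n

/-- Membership in `sysPart`. [folklore] -/
@[simp] theorem mem_sysPart {J : Finset ℕ} {v : ℕ} : v ∈ sysPart n J ↔ v ∈ J ∧ v < n := by
  simp [sysPart]

/-- **Derivable sets are small**: if the row supports form an `(r, c)`-boundary expander with
`c > 0` and `|J ∩ [n]| ≤ c r / 4`, then every derivable `I` satisfies `(c/2)|I| ≤ |J ∩ [n]|`
(so `2|I| ≤ r`). Induction along the derivation: `I ∪ I'` has at most `r/2 + r/2 = r` rows, so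
expansion applies, and `c|I ∪ I'| ≤ |∂| ≤ |J ∩ [n]| + (c/2)|I ∪ I'|`.
[Alekhnovich 2011, §3, Lemma 3.x (closure of a small set is small)] [folklore] -/
theorem IsDerivable.half_c_mul_card_le (hexp : IsBoundaryExpander (rowVars E) r c) (hc : 0 < c)
    (hJ : ((sysPart n J).card : ℝ) ≤ c * r / 4) {I : Finset (Fin m)} (h : IsDerivable E r c J I) :
    c / 2 * I.card ≤ ((sysPart n J).card : ℝ) := by
  induction h with
  | empty => simp
  | @step I I' hI hdisj hne hsmall hbd ih =>
    have hder : IsDerivable E r c J (I ∪ I') := IsDerivable.step hI hdisj hne hsmall hbd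
    -- `I` is small by induction, so `I ∪ I'` has at most `r` rows
    have hIle : 2 * (I.card : ℝ) ≤ r := by
      have : c / 2 * I.card ≤ c * r / 4 := ih.trans hJ
      nlinarith
    have hU : ((I ∪ I').card : ℝ) ≤ r := by
      rw [Finset.card_union_of_disjoint hdisj, Nat.cast_add]
      linarith
    have h1 : c * (I ∪ I').card ≤ ((boundary (rowVars E) (I ∪ I')).card : ℝ) := hexp _ hU
    have h2 := hder.card_boundary_sdiff_le
    -- split the boundary into the part inside `J` (hence inside `J ∩ [n]`) and the rest
    have h3 : (boundary (rowVars E) (I ∪ I')).card ≤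
        (sysPart n J).card + ((boundary (rowVars E) (I ∪ I')) \ J).card := by
      calc (boundary (rowVars E) (I ∪ I')).card
          ≤ ((boundary (rowVars E) (I ∪ I')) ∩ J).card +
              ((boundary (rowVars E) (I ∪ I')) \ J).card := by
            rw [Finset.card_inter_add_card_sdiff]
        _ ≤ (sysPart n J).card + ((boundary (rowVars E) (I ∪ I')) \ J).card := by
            gcongr
            intro v hv
            rw [Finset.mem_inter] at hv
            exact mem_sysPart.2 ⟨hv.2, lt_of_mem_boundary hv.1⟩
    have h3' : ((boundary (rowVars E) (I ∪ I')).card : ℝ) ≤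
        (sysPart n J).card + ((boundary (rowVars E) (I ∪ I')) \ J).card := by exact_mod_cast h3
    linarith

/-- Under the hypotheses of `half_c_mul_card_le`, a derivable set has at most `r/2` rows.
[Alekhnovich 2011, §3] [folklore] -/
theorem IsDerivable.two_mul_card_le (hexp : IsBoundaryExpander (rowVars E) r c) (hc : 0 < c)
    (hJ : ((sysPart n J).card : ℝ) ≤ c * r / 4) {I : Finset (Fin m)} (h : IsDerivable E r c J I) :
    2 * (I.card : ℝ) ≤ r := by
  have := (h.half_c_mul_card_le hexp hc hJ).trans hJ
  nlinarith

/-! ### The closure: a derivable set of maximum size -/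

/-- There is a derivable set of maximum cardinality. [folklore] -/
theorem exists_max_isDerivable (E : Fin m → LinEqMod 2 n) (r c : ℝ) (J : Finset ℕ) :
    ∃ I : Finset (Fin m), IsDerivable E r c J I ∧
      ∀ I₂ : Finset (Fin m), IsDerivable E r c J I₂ → I₂.card ≤ I.card := by
  classical
  obtain ⟨I, hI, hmax⟩ := Finset.exists_max_image
    ((Finset.univ : Finset (Finset (Fin m))).filter fun I => IsDerivable E r c J I) Finset.card
    ⟨∅, by simp [IsDerivable.empty]⟩
  rw [Finset.mem_filter] at hI
  exact ⟨I, hI.2, fun I₂ h₂ => hmax I₂ (by simp [h₂])⟩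

/-- The CLOSURE of the variable set `J`: a derivable row set of maximum cardinality.
[Alekhnovich 2011, §3 (closure `Cl(J)`)] [folklore] -/
noncomputable def closure (E : Fin m → LinEqMod 2 n) (r c : ℝ) (J : Finset ℕ) : Finset (Fin m) :=
  Classical.choose (exists_max_isDerivable E r c J)

/-- The closure is derivable. [folklore] -/
theorem isDerivable_closure (E : Fin m → LinEqMod 2 n) (r c : ℝ) (J : Finset ℕ) :
    IsDerivable E r c J (closure E r c J) :=
  (Classical.choose_spec (exists_max_isDerivable E r c J)).1

/-- The closure has maximum cardinality among derivable sets. [folklore] -/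
theorem card_le_card_closure {I : Finset (Fin m)} (h : IsDerivable E r c J I) :
    I.card ≤ (closure E r c J).card :=
  (Classical.choose_spec (exists_max_isDerivable E r c J)).2 I h

/-- The ASSIGNED variables of the restriction: `J` together with all variables of closure rows.
[Alekhnovich 2011, §3] [folklore] -/
noncomputable def assigned (E : Fin m → LinEqMod 2 n) (r c : ℝ) (J : Finset ℕ) : Finset ℕ :=
  J ∪ cover (rowVars E) (closure E r c J)

/-- `J ⊆ assigned`. [folklore] -/
theorem subset_assigned : J ⊆ assigned E r c J := Finset.subset_union_left

/-- Variables of closure rows are assigned. [folklore] -/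
theorem rowVars_subset_assigned {i : Fin m} (hi : i ∈ closure E r c J) :
    rowVars E i ⊆ assigned E r c J :=
  (subset_cover (S := rowVars E) hi).trans Finset.subset_union_right

/-- The closure has at most `r/2` rows (when `|J ∩ [n]| ≤ c r / 4`). [Alekhnovich 2011, §3] [folklore] -/
theorem two_mul_card_closure_le (hexp : IsBoundaryExpander (rowVars E) r c) (hc : 0 < c)
    (hJ : ((sysPart n J).card : ℝ) ≤ c * r / 4) : 2 * ((closure E r c J).card : ℝ) ≤ r :=
  (isDerivable_closure E r c J).two_mul_card_le hexp hc hJ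

/-- **Maximality of the closure**: a nonempty family `F` of at most `r/2` rows outside the
closure has more than `(c/2)|F|` boundary points outside the assigned variables (otherwise it
could be adjoined, contradicting maximality). [Alekhnovich 2011, §3 (the restricted system is an
expander)] [folklore] -/
theorem lt_card_boundary_sdiff_assigned {F : Finset (Fin m)} (hdisj : Disjoint (closure E r c J) F)
    (hne : F.Nonempty) (hsmall : 2 * (F.card : ℝ) ≤ r) :
    c / 2 * F.card < (((boundary (rowVars E) F) \ assigned E r c J).card : ℝ) := by
  by_contra h
  push Not at h
  have hder : IsDerivable E r c J (closure E r c J ∪ F) :=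
    IsDerivable.step (isDerivable_closure E r c J) hdisj hne hsmall h
  have h1 := card_le_card_closure hder
  rw [Finset.card_union_of_disjoint hdisj] at h1
  have h2 := Finset.card_pos.2 hne
  omega

/-- `RelExpander E Icl A r' c'`: the rows outside `Icl` form an `(r', c')`-boundary expander once
the variables in `A` are disregarded — every family `F` of at most `r'` rows disjoint from `Icl`
has at least `c'|F|` boundary points outside `A`. [Alekhnovich 2011, §3] [folklore] -/
def RelExpander (E : Fin m → LinEqMod 2 n) (Icl : Finset (Fin m)) (A : Finset ℕ) (r' c' : ℝ) : Prop :=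
  ∀ F : Finset (Fin m), Disjoint Icl F → (F.card : ℝ) ≤ r' →
    c' * F.card ≤ (((boundary (rowVars E) F) \ A).card : ℝ)

/-- **The rows outside the closure form an `(r/2, c/2)`-expander relative to the assigned
variables.** [Alekhnovich 2011, §3] [folklore] -/
theorem relExpander_closure (E : Fin m → LinEqMod 2 n) (r c : ℝ) (J : Finset ℕ) :
    RelExpander E (closure E r c J) (assigned E r c J) (r / 2) (c / 2) := by
  intro F hdisj hF
  rcases F.eq_empty_or_nonempty with rfl | hne
  · simp
  · exact (lt_card_boundary_sdiff_assigned hdisj hne (by linarith)).le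

/-- In particular every row outside the closure keeps a variable outside the assigned set
(when `c > 0`). [Alekhnovich 2011, §3] [folklore] -/
theorem exists_mem_rowVars_not_mem_assigned (hc : 0 < c) (hr : 2 ≤ r) {i : Fin m}
    (hi : i ∉ closure E r c J) : ∃ v ∈ rowVars E i, v ∉ assigned E r c J := by
  have h := lt_card_boundary_sdiff_assigned (E := E) (r := r) (c := c) (J := J) (F := {i})
    (Finset.disjoint_singleton_right.2 hi) ⟨i, Finset.mem_singleton_self i⟩ (by simp; linarith)
  have hpos : (0 : ℝ) < (((boundary (rowVars E) {i}) \ assigned E r c J).card : ℝ) :=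
    lt_of_le_of_lt (by simp; linarith) h
  have hpos' : 0 < ((boundary (rowVars E) {i}) \ assigned E r c J).card := by exact_mod_cast hpos
  obtain ⟨v, hv⟩ := Finset.card_pos.1 hpos'
  rw [Finset.mem_sdiff] at hv
  refine ⟨v, ?_, hv.2⟩
  have := boundary_subset_cover (S := rowVars E) {i} hv.1
  simpa [cover] using this

end Summit.PneNP.PneNP.Theorems.ResKRestriction
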